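import Summits.HodgeConjecture.HodgeConjecture.Theorems.Ring2WeilCoverageWeilGramLevel24
import HarnessLib

/-!
# Weil-type family coverage — THE COMPONENTS OF THE WEIL-TYPE `ℤ[ζ₂₄]`-FOURFOLDS, II: `K_d = ℚ(√−2)` (`s₂ = ζ³ + ζ⁹`)
# and `ℚ(√−3)` (`s₃ = 1 + 2ζ⁸`): principal-type Gram determinants `64 = 8²` and `144 = 12²` — SPLIT, right sign:
# rows W4.2.1 and W4.3.1

research route conditional on HC_CM; not a corollary; Q11.4-sentence-2 already refuted in dim ≥ 3.

Ring 2, WEIL-TYPE FAMILY-COVERAGE CENSUS (`HOME/WEIL-FAMILY-COVERAGE.md` `## b01`, block b01.46 (C2)), part 90 of the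
`Ring2WeilCoverage*` series; continues part 89 (frame `θ^i`, `ξ = ζ³/Φ₂₄′(ζ)`).

* §0 `s₂ = ζ³ + ζ⁹` (`= ζ₈ + ζ₈³`) is skew with `s₂² = −2`; `s₃ = 1 + 2ζ⁸` (`ζ⁸ = ζ₃`) is skew with `s₃² = −3`.
* §1 `(E_ξ, s₂)`: **`a = −(0,2,0,6 / 2,0,6,0 / 0,6,0,22 / 6,0,22,0)`, `det a = 64`**; §2 `(E_ξ, s₃)`:
  **`a = −(2,0,4,0 / 0,4,0,14 / 4,0,14,0 / 0,14,0,52)`, `det a = 144`**.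
* §3 EVERY skew `ζ′` of principal type gives `64` resp. `144` (THEOREM L (i) at `24`); such `Φ`-positive `ζ′` exist on
  every balanced `Φ` (part 75 `exists_principal_twentyFour_sqrt_neg_two/_neg_three`); classes **`[64] = [1]`**,
  **`[144] = [1]`** = SPLIT, right sign — rows W4.2.1, W4.3.1.

HONEST FRAMING as parts 82–89; `HC_CM` is used nowhere.  No `def`, no named fact, no `sorry`.  Certificates from
`work/py/gen24.py`, re-verified by `linear_combination`.

References: [cite: vanGeemen1994HodgeAV, Lemma 5.2 (2)–(4), 5.4 and (5.4.1)]; [cite: Shimura1998, §14.3 Prop. 4–5,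
pp. 103–104]; census b01.46 (C2) (seat-derived).
-/

noncomputable section

open Polynomial NumberField Module
open scoped nonZeroDivisors

namespace Summit.HodgeConjecture.Ring2WeilCoverage.WeilGramLevel24SqrtNegTwoThree

open Literature.AlgebraicGeometry.VanGeemen1994 (weilField weilNormResidueGroup)
open Literature.AlgebraicGeometry.Motives (normUnitsSubgroup)
open Literature.NumberTheory.ComplexMultiplication
open Summit.HodgeConjecture.Ring2WeilCoverage.TraceGramDeterminant (trace_aeval_zeta_mul_inv)
open Summit.HodgeConjecture.Ring2WeilCoverage.WeilGramCMPoint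
open Summit.HodgeConjecture.Ring2WeilCoverage.RealUnitNormHalfSystems (complexConj_eq_inv)
open Summit.HodgeConjecture.Ring2WeilCoverage.CyclotomicPrincipalObstruction (complexConj_xi)
open Summit.HodgeConjecture.Ring2WeilCoverage.CyclotomicDifferent (isOfType_one_xi_top xi_ne_zero)
open Summit.HodgeConjecture.Ring2WeilCoverage.RealUnitNormAllLevels (norm_realUnits_pos_twentyFour)
open Summit.HodgeConjecture.HodgeConjecture.Ring2.WeilCoverage (mk_eq_split_of_even mem_normUnitsSubgroup_of_sq_add_mul_sq)
open Summit.HodgeConjecture.HodgeConjecture.Ring2.Hypotheses (splitDiscriminantClass)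
open Summit.HodgeConjecture.Ring2WeilCoverage.WeilGramLevel24
variable {K : Type} [Field K] [NumberField K] {ζ : K}

/-! ### §0 `s₂ = ζ³ + ζ⁹`, `s₃ = 1 + 2ζ⁸` -/

omit [NumberField K] in
/-- **`s₂² = −2`.** [folklore] -/
theorem sq_sqrtNegTwo (hζ : IsPrimitiveRoot ζ 24) : (ζ ^ 3 + ζ ^ 9) ^ 2 = -2 := by
  linear_combination (2 + 2 * ζ ^ 4 + ζ ^ 6 + ζ ^ 10) * cyc_twentyFour hζ

/-- **`s₂` is skew.** [folklore] -/
theorem complexConj_sqrtNegTwo [IsCMField K] (hζ : IsPrimitiveRoot ζ 24) :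
    IsCMField.complexConj K (ζ ^ 3 + ζ ^ 9) = -(ζ ^ 3 + ζ ^ 9) := by
  rw [map_add, map_pow, map_pow, complexConj_eq_inv hζ, inv_pow_eq_pow hζ (show 3 + 21 = 24 by norm_num),
    inv_pow_eq_pow hζ (show 9 + 15 = 24 by norm_num)]
  linear_combination (ζ ^ 3 + ζ ^ 7 + ζ ^ 9 + ζ ^ 13) * cyc_twentyFour hζ

omit [NumberField K] in
/-- **`s₃² = −3`.** [folklore] -/
theorem sq_sqrtNegThree (hζ : IsPrimitiveRoot ζ 24) : (1 + 2 * ζ ^ 8) ^ 2 = -3 := by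
  linear_combination (4 + 4 * ζ ^ 4 + 4 * ζ ^ 8) * cyc_twentyFour hζ

/-- **`s₃` is skew.** [folklore] -/
theorem complexConj_sqrtNegThree [IsCMField K] (hζ : IsPrimitiveRoot ζ 24) :
    IsCMField.complexConj K (1 + 2 * ζ ^ 8) = -(1 + 2 * ζ ^ 8) := by
  rw [map_add, map_mul, map_pow, complexConj_eq_inv hζ, map_one, map_ofNat, inv_pow_eq_pow hζ (show 8 + 16 = 24 by norm_num)]
  linear_combination (2 + 2 * ζ ^ 4 + 2 * ζ ^ 8) * cyc_twentyFour hζ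

/-! ### §1 The principal-type form for `K_d = ℚ(√−2)`: `det = 64` -/

/-- `Tr(ζ′sθ^0) = 0` for `ζ′ = ξ = ζ³/Φ′(ζ)`, `s = √−2 = ζ³ + ζ⁹`, `θ = ζ + ζ⁻¹` (Euler evaluation). research route conditional on HC_CM; not a corollary; Q11.4-sentence-2 already refuted in dim ≥ 3. [folklore] -/
theorem trace_xi_sqrtNegTwo_zero [IsCyclotomicExtension {24} ℚ K] (hζ : IsPrimitiveRoot ζ 24) :
    Algebra.trace ℚ K ((ζ ^ 3 * (aeval ζ (derivative (cyclotomic 24 ℚ)))⁻¹) * (ζ ^ 3 + ζ ^ 9)) = 0 := by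
  have hΦ := cyc_twentyFour hζ
  rw [trace_of_key₀ hζ (C (-1 : ℚ) + C (0 : ℚ) * X + C (0 : ℚ) * X ^ 2 + C (0 : ℚ) * X ^ 3 + C (0 : ℚ) * X ^ 4 + C (0 : ℚ) * X ^ 5 +
      C (1 : ℚ) * X ^ 6 + C (0 : ℚ) * X ^ 7) (by compute_degree) (by
    rw [aeval_poly₈]
    push_cast
    linear_combination ((aeval ζ (derivative (cyclotomic 24 ℚ)))⁻¹ * (1 + ζ^4)) * hΦ)]
  norm_num [coeff_X_pow, coeff_X, coeff_C, coeff_one]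

/-- `Tr(ζ′sθ^1) = 2` for `ζ′ = ξ = ζ³/Φ′(ζ)`, `s = √−2 = ζ³ + ζ⁹`, `θ = ζ + ζ⁻¹` (Euler evaluation). research route conditional on HC_CM; not a corollary; Q11.4-sentence-2 already refuted in dim ≥ 3. [folklore] -/
theorem trace_xi_sqrtNegTwo_one [IsCyclotomicExtension {24} ℚ K] (hζ : IsPrimitiveRoot ζ 24) :
    Algebra.trace ℚ K ((ζ ^ 3 * (aeval ζ (derivative (cyclotomic 24 ℚ)))⁻¹) * (ζ ^ 3 + ζ ^ 9) * (ζ + ζ⁻¹)) = 2 := by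
  have hΦ := cyc_twentyFour hζ
  rw [trace_of_key₁ hζ (C (0 : ℚ) + C (-1 : ℚ) * X + C (0 : ℚ) * X ^ 2 + C (-1 : ℚ) * X ^ 3 + C (0 : ℚ) * X ^ 4 +
      C (1 : ℚ) * X ^ 5 + C (0 : ℚ) * X ^ 6 + C (2 : ℚ) * X ^ 7) (by compute_degree) (by
    rw [aeval_poly₈]
    push_cast
    linear_combination ((aeval ζ (derivative (cyclotomic 24 ℚ)))⁻¹ * (ζ^2 + ζ^4 + ζ^6)) * hΦ)]
  norm_num [coeff_X_pow, coeff_X, coeff_C, coeff_one]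

/-- `Tr(ζ′sθ^2) = 0` for `ζ′ = ξ = ζ³/Φ′(ζ)`, `s = √−2 = ζ³ + ζ⁹`, `θ = ζ + ζ⁻¹` (Euler evaluation). research route conditional on HC_CM; not a corollary; Q11.4-sentence-2 already refuted in dim ≥ 3. [folklore] -/
theorem trace_xi_sqrtNegTwo_two [IsCyclotomicExtension {24} ℚ K] (hζ : IsPrimitiveRoot ζ 24) :
    Algebra.trace ℚ K ((ζ ^ 3 * (aeval ζ (derivative (cyclotomic 24 ℚ)))⁻¹) * (ζ ^ 3 + ζ ^ 9) * (ζ + ζ⁻¹) ^ 2) = 0 := by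
  have hΦ := cyc_twentyFour hζ
  rw [trace_of_key hζ (C (-3 : ℚ) + C (0 : ℚ) * X + C (-2 : ℚ) * X ^ 2 + C (0 : ℚ) * X ^ 3 + C (2 : ℚ) * X ^ 4 +
      C (0 : ℚ) * X ^ 5 + C (3 : ℚ) * X ^ 6 + C (0 : ℚ) * X ^ 7) (by compute_degree) (by
    rw [aeval_poly₈]
    push_cast
    linear_combination ((aeval ζ (derivative (cyclotomic 24 ℚ)))⁻¹ * (3 * ζ^2 + 2 * ζ^4 + 2 * ζ^6 + ζ^8)) * hΦ)]
  norm_num [coeff_X_pow, coeff_X, coeff_C, coeff_one]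

/-- `Tr(ζ′sθ^3) = 6` for `ζ′ = ξ = ζ³/Φ′(ζ)`, `s = √−2 = ζ³ + ζ⁹`, `θ = ζ + ζ⁻¹` (Euler evaluation). research route conditional on HC_CM; not a corollary; Q11.4-sentence-2 already refuted in dim ≥ 3. [folklore] -/
theorem trace_xi_sqrtNegTwo_three [IsCyclotomicExtension {24} ℚ K] (hζ : IsPrimitiveRoot ζ 24) :
    Algebra.trace ℚ K ((ζ ^ 3 * (aeval ζ (derivative (cyclotomic 24 ℚ)))⁻¹) * (ζ ^ 3 + ζ ^ 9) * (ζ + ζ⁻¹) ^ 3) = 6 := by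
  have hΦ := cyc_twentyFour hζ
  rw [trace_of_key hζ (C (0 : ℚ) + C (-5 : ℚ) * X + C (0 : ℚ) * X ^ 2 + C (-3 : ℚ) * X ^ 3 + C (0 : ℚ) * X ^ 4 +
      C (5 : ℚ) * X ^ 5 + C (0 : ℚ) * X ^ 6 + C (6 : ℚ) * X ^ 7) (by compute_degree) (by
    rw [aeval_poly₈]
    push_cast
    linear_combination ((aeval ζ (derivative (cyclotomic 24 ℚ)))⁻¹ * (5 * ζ^4 + 4 * ζ^6 + 3 * ζ^8 + ζ^10)) * hΦ)]
  norm_num [coeff_X_pow, coeff_X, coeff_C, coeff_one]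

/-- `Tr(ζ′sθ^4) = 0` for `ζ′ = ξ = ζ³/Φ′(ζ)`, `s = √−2 = ζ³ + ζ⁹`, `θ = ζ + ζ⁻¹` (Euler evaluation). research route conditional on HC_CM; not a corollary; Q11.4-sentence-2 already refuted in dim ≥ 3. [folklore] -/
theorem trace_xi_sqrtNegTwo_four [IsCyclotomicExtension {24} ℚ K] (hζ : IsPrimitiveRoot ζ 24) :
    Algebra.trace ℚ K ((ζ ^ 3 * (aeval ζ (derivative (cyclotomic 24 ℚ)))⁻¹) * (ζ ^ 3 + ζ ^ 9) * (ζ + ζ⁻¹) ^ 4) = 0 := by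
  have hΦ := cyc_twentyFour hζ
  rw [trace_of_key hζ (C (-11 : ℚ) + C (0 : ℚ) * X + C (-8 : ℚ) * X ^ 2 + C (0 : ℚ) * X ^ 3 + C (8 : ℚ) * X ^ 4 +
      C (0 : ℚ) * X ^ 5 + C (11 : ℚ) * X ^ 6 + C (0 : ℚ) * X ^ 7) (by compute_degree) (by
    rw [aeval_poly₈]
    push_cast
    linear_combination ((aeval ζ (derivative (cyclotomic 24 ℚ)))⁻¹ * (11 * ζ^4 + 9 * ζ^6 + 7 * ζ^8 + 4 * ζ^10 + ζ^12)) * hΦ)]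
  norm_num [coeff_X_pow, coeff_X, coeff_C, coeff_one]

/-- `Tr(ζ′sθ^5) = 22` for `ζ′ = ξ = ζ³/Φ′(ζ)`, `s = √−2 = ζ³ + ζ⁹`, `θ = ζ + ζ⁻¹` (Euler evaluation). research route conditional on HC_CM; not a corollary; Q11.4-sentence-2 already refuted in dim ≥ 3. [folklore] -/
theorem trace_xi_sqrtNegTwo_five [IsCyclotomicExtension {24} ℚ K] (hζ : IsPrimitiveRoot ζ 24) :
    Algebra.trace ℚ K ((ζ ^ 3 * (aeval ζ (derivative (cyclotomic 24 ℚ)))⁻¹) * (ζ ^ 3 + ζ ^ 9) * (ζ + ζ⁻¹) ^ 5) = 22 := by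
  have hΦ := cyc_twentyFour hζ
  rw [trace_of_key hζ (C (0 : ℚ) + C (-19 : ℚ) * X + C (0 : ℚ) * X ^ 2 + C (-11 : ℚ) * X ^ 3 + C (0 : ℚ) * X ^ 4 +
      C (19 : ℚ) * X ^ 5 + C (0 : ℚ) * X ^ 6 + C (22 : ℚ) * X ^ 7) (by compute_degree) (by
    rw [aeval_poly₈]
    push_cast
    linear_combination ((aeval ζ (derivative (cyclotomic 24 ℚ)))⁻¹ * (20 * ζ^6 + 16 * ζ^8 + 11 * ζ^10 + 5 * ζ^12 + ζ^14)) * hΦ)]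
  norm_num [coeff_X_pow, coeff_X, coeff_C, coeff_one]

/-- `Tr(ζ′sθ^6) = 0` for `ζ′ = ξ = ζ³/Φ′(ζ)`, `s = √−2 = ζ³ + ζ⁹`, `θ = ζ + ζ⁻¹` (Euler evaluation). research route conditional on HC_CM; not a corollary; Q11.4-sentence-2 already refuted in dim ≥ 3. [folklore] -/
theorem trace_xi_sqrtNegTwo_six [IsCyclotomicExtension {24} ℚ K] (hζ : IsPrimitiveRoot ζ 24) :
    Algebra.trace ℚ K ((ζ ^ 3 * (aeval ζ (derivative (cyclotomic 24 ℚ)))⁻¹) * (ζ ^ 3 + ζ ^ 9) * (ζ + ζ⁻¹) ^ 6) = 0 := by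
  have h24 : ζ ^ 24 = 1 := hζ.pow_eq_one
  have hΦ := cyc_twentyFour hζ
  rw [trace_of_key hζ (C (-41 : ℚ) + C (0 : ℚ) * X + C (-30 : ℚ) * X ^ 2 + C (0 : ℚ) * X ^ 3 + C (30 : ℚ) * X ^ 4 +
      C (0 : ℚ) * X ^ 5 + C (41 : ℚ) * X ^ 6 + C (0 : ℚ) * X ^ 7) (by compute_degree) (by
    rw [aeval_poly₈]
    push_cast
    linear_combination ((aeval ζ (derivative (cyclotomic 24 ℚ)))⁻¹ * (1 + ζ^4 + 42 * ζ^6 + 36 * ζ^8 + 27 * ζ^10 + 15 * ζ^12 +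
        6 * ζ^14)) * hΦ +
      ((aeval ζ (derivative (cyclotomic 24 ℚ)))⁻¹ * (1)) * h24)]
  norm_num [coeff_X_pow, coeff_X, coeff_C, coeff_one]

/-- **The Gram datum `a` of `(E_ζ′, s)` in the real frame `θ^i` (`i < 4`)** for `ζ′ = ξ = ζ³/Φ′(ζ)` (principal type (1)),
`s = √−2 = ζ³ + ζ⁹`: the integer Hankel matrix `(−Tr(ζ′sθ^{i+j}))ᵢⱼ` (and `b = 0`, part 82 `hb_eq_zero`).
research route conditional on HC_CM; not a corollary; Q11.4-sentence-2 already refuted in dim ≥ 3. [cite: vanGeemen1994HodgeAV, Lemma 5.2 (2)–(3)] -/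
theorem realPart_xi_sqrtNegTwo [IsCyclotomicExtension {24} ℚ K] [IsCMField K] (hζ : IsPrimitiveRoot ζ 24)
    {x : Fin 4 → K} (hx : ∀ i, x i = (ζ + ζ⁻¹) ^ (i : ℕ)) {a : Matrix (Fin 4) (Fin 4) ℚ}
    (ha : ∀ i j, a i j = Algebra.trace ℚ K ((ζ ^ 3 * (aeval ζ (derivative (cyclotomic 24 ℚ)))⁻¹) * x i * IsCMField.complexConj K ((ζ ^ 3 + ζ ^ 9) * x j))) :
    a = !![0, -2, 0, -6; -2, 0, -6, 0; 0, -6, 0, -22; -6, 0, -22, 0] := by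
  rw [ha_eq (complexConj_sqrtNegTwo hζ) (complexConj_thetaFrame hζ hx) ha]
  ext i j
  simp only [Matrix.of_apply, hx, ← pow_add]
  fin_cases i <;> fin_cases j <;> simp [trace_xi_sqrtNegTwo_zero hζ, trace_xi_sqrtNegTwo_one hζ, trace_xi_sqrtNegTwo_two hζ, trace_xi_sqrtNegTwo_three hζ, trace_xi_sqrtNegTwo_four hζ, trace_xi_sqrtNegTwo_five hζ, trace_xi_sqrtNegTwo_six hζ]

/-- **`det a = 64`** for `ζ′ = ξ = ζ³/Φ′(ζ)`, `s = √−2 = ζ³ + ζ⁹` (frame `θ^i`). research route conditional on HC_CM; not a corollary; Q11.4-sentence-2 already refuted in dim ≥ 3. [cite: vanGeemen1994HodgeAV, Lemma 5.2 (3)] -/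
theorem det_realPart_xi_sqrtNegTwo [IsCyclotomicExtension {24} ℚ K] [IsCMField K] (hζ : IsPrimitiveRoot ζ 24)
    {x : Fin 4 → K} (hx : ∀ i, x i = (ζ + ζ⁻¹) ^ (i : ℕ)) {a : Matrix (Fin 4) (Fin 4) ℚ}
    (ha : ∀ i j, a i j = Algebra.trace ℚ K ((ζ ^ 3 * (aeval ζ (derivative (cyclotomic 24 ℚ)))⁻¹) * x i * IsCMField.complexConj K ((ζ ^ 3 + ζ ^ 9) * x j))) :
    a.det = 64 := by
  rw [realPart_xi_sqrtNegTwo hζ hx ha]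
  simp [Matrix.det_succ_row_zero, Fin.sum_univ_succ, Fin.succAbove, Matrix.submatrix]
  norm_num

/-! ### §2 The principal-type form for `K_d = ℚ(√−3)`: `det = 144` -/

/-- `Tr(ζ′sθ^0) = 2` for `ζ′ = ξ = ζ³/Φ′(ζ)`, `s = √−3 = 1 + 2ζ⁸`, `θ = ζ + ζ⁻¹` (Euler evaluation). research route conditional on HC_CM; not a corollary; Q11.4-sentence-2 already refuted in dim ≥ 3. [folklore] -/
theorem trace_xi_sqrtNegThree_zero [IsCyclotomicExtension {24} ℚ K] (hζ : IsPrimitiveRoot ζ 24) :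
    Algebra.trace ℚ K ((ζ ^ 3 * (aeval ζ (derivative (cyclotomic 24 ℚ)))⁻¹) * (1 + 2 * ζ ^ 8)) = 2 := by
  have hΦ := cyc_twentyFour hζ
  rw [trace_of_key₀ hζ (C (0 : ℚ) + C (0 : ℚ) * X + C (0 : ℚ) * X ^ 2 + C (-1 : ℚ) * X ^ 3 + C (0 : ℚ) * X ^ 4 + C (0 : ℚ) * X ^ 5 +
      C (0 : ℚ) * X ^ 6 + C (2 : ℚ) * X ^ 7) (by compute_degree) (by
    rw [aeval_poly₈]
    push_cast
    linear_combination ((aeval ζ (derivative (cyclotomic 24 ℚ)))⁻¹ * (2 * ζ^3)) * hΦ)]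
  norm_num [coeff_X_pow, coeff_X, coeff_C, coeff_one]

/-- `Tr(ζ′sθ^1) = 0` for `ζ′ = ξ = ζ³/Φ′(ζ)`, `s = √−3 = 1 + 2ζ⁸`, `θ = ζ + ζ⁻¹` (Euler evaluation). research route conditional on HC_CM; not a corollary; Q11.4-sentence-2 already refuted in dim ≥ 3. [folklore] -/
theorem trace_xi_sqrtNegThree_one [IsCyclotomicExtension {24} ℚ K] (hζ : IsPrimitiveRoot ζ 24) :
    Algebra.trace ℚ K ((ζ ^ 3 * (aeval ζ (derivative (cyclotomic 24 ℚ)))⁻¹) * (1 + 2 * ζ ^ 8) * (ζ + ζ⁻¹)) = 0 := by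
  have hΦ := cyc_twentyFour hζ
  rw [trace_of_key₁ hζ (C (-2 : ℚ) + C (0 : ℚ) * X + C (-1 : ℚ) * X ^ 2 + C (0 : ℚ) * X ^ 3 + C (1 : ℚ) * X ^ 4 +
      C (0 : ℚ) * X ^ 5 + C (2 : ℚ) * X ^ 6 + C (0 : ℚ) * X ^ 7) (by compute_degree) (by
    rw [aeval_poly₈]
    push_cast
    linear_combination ((aeval ζ (derivative (cyclotomic 24 ℚ)))⁻¹ * (2 * ζ + 2 * ζ^3 + 2 * ζ^5)) * hΦ)]
  norm_num [coeff_X_pow, coeff_X, coeff_C, coeff_one]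

/-- `Tr(ζ′sθ^2) = 4` for `ζ′ = ξ = ζ³/Φ′(ζ)`, `s = √−3 = 1 + 2ζ⁸`, `θ = ζ + ζ⁻¹` (Euler evaluation). research route conditional on HC_CM; not a corollary; Q11.4-sentence-2 already refuted in dim ≥ 3. [folklore] -/
theorem trace_xi_sqrtNegThree_two [IsCyclotomicExtension {24} ℚ K] (hζ : IsPrimitiveRoot ζ 24) :
    Algebra.trace ℚ K ((ζ ^ 3 * (aeval ζ (derivative (cyclotomic 24 ℚ)))⁻¹) * (1 + 2 * ζ ^ 8) * (ζ + ζ⁻¹) ^ 2) = 4 := by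
  have hΦ := cyc_twentyFour hζ
  rw [trace_of_key hζ (C (0 : ℚ) + C (-3 : ℚ) * X + C (0 : ℚ) * X ^ 2 + C (-2 : ℚ) * X ^ 3 + C (0 : ℚ) * X ^ 4 +
      C (3 : ℚ) * X ^ 5 + C (0 : ℚ) * X ^ 6 + C (4 : ℚ) * X ^ 7) (by compute_degree) (by
    rw [aeval_poly₈]
    push_cast
    linear_combination ((aeval ζ (derivative (cyclotomic 24 ℚ)))⁻¹ * (4 * ζ^3 + 4 * ζ^5 + 2 * ζ^7)) * hΦ)]
  norm_num [coeff_X_pow, coeff_X, coeff_C, coeff_one]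

/-- `Tr(ζ′sθ^3) = 0` for `ζ′ = ξ = ζ³/Φ′(ζ)`, `s = √−3 = 1 + 2ζ⁸`, `θ = ζ + ζ⁻¹` (Euler evaluation). research route conditional on HC_CM; not a corollary; Q11.4-sentence-2 already refuted in dim ≥ 3. [folklore] -/
theorem trace_xi_sqrtNegThree_three [IsCyclotomicExtension {24} ℚ K] (hζ : IsPrimitiveRoot ζ 24) :
    Algebra.trace ℚ K ((ζ ^ 3 * (aeval ζ (derivative (cyclotomic 24 ℚ)))⁻¹) * (1 + 2 * ζ ^ 8) * (ζ + ζ⁻¹) ^ 3) = 0 := by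
  have hΦ := cyc_twentyFour hζ
  rw [trace_of_key hζ (C (-7 : ℚ) + C (0 : ℚ) * X + C (-5 : ℚ) * X ^ 2 + C (0 : ℚ) * X ^ 3 + C (5 : ℚ) * X ^ 4 +
      C (0 : ℚ) * X ^ 5 + C (7 : ℚ) * X ^ 6 + C (0 : ℚ) * X ^ 7) (by compute_degree) (by
    rw [aeval_poly₈]
    push_cast
    linear_combination ((aeval ζ (derivative (cyclotomic 24 ℚ)))⁻¹ * (8 * ζ^3 + 8 * ζ^5 + 6 * ζ^7 + 2 * ζ^9)) * hΦ)]
  norm_num [coeff_X_pow, coeff_X, coeff_C, coeff_one]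

/-- `Tr(ζ′sθ^4) = 14` for `ζ′ = ξ = ζ³/Φ′(ζ)`, `s = √−3 = 1 + 2ζ⁸`, `θ = ζ + ζ⁻¹` (Euler evaluation). research route conditional on HC_CM; not a corollary; Q11.4-sentence-2 already refuted in dim ≥ 3. [folklore] -/
theorem trace_xi_sqrtNegThree_four [IsCyclotomicExtension {24} ℚ K] (hζ : IsPrimitiveRoot ζ 24) :
    Algebra.trace ℚ K ((ζ ^ 3 * (aeval ζ (derivative (cyclotomic 24 ℚ)))⁻¹) * (1 + 2 * ζ ^ 8) * (ζ + ζ⁻¹) ^ 4) = 14 := by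
  have hΦ := cyc_twentyFour hζ
  rw [trace_of_key hζ (C (0 : ℚ) + C (-12 : ℚ) * X + C (0 : ℚ) * X ^ 2 + C (-7 : ℚ) * X ^ 3 + C (0 : ℚ) * X ^ 4 +
      C (12 : ℚ) * X ^ 5 + C (0 : ℚ) * X ^ 6 + C (14 : ℚ) * X ^ 7) (by compute_degree) (by
    rw [aeval_poly₈]
    push_cast
    linear_combination ((aeval ζ (derivative (cyclotomic 24 ℚ)))⁻¹ * (ζ^3 + 16 * ζ^5 + 14 * ζ^7 + 8 * ζ^9 + 2 * ζ^11)) * hΦ)]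
  norm_num [coeff_X_pow, coeff_X, coeff_C, coeff_one]

/-- `Tr(ζ′sθ^5) = 0` for `ζ′ = ξ = ζ³/Φ′(ζ)`, `s = √−3 = 1 + 2ζ⁸`, `θ = ζ + ζ⁻¹` (Euler evaluation). research route conditional on HC_CM; not a corollary; Q11.4-sentence-2 already refuted in dim ≥ 3. [folklore] -/
theorem trace_xi_sqrtNegThree_five [IsCyclotomicExtension {24} ℚ K] (hζ : IsPrimitiveRoot ζ 24) :
    Algebra.trace ℚ K ((ζ ^ 3 * (aeval ζ (derivative (cyclotomic 24 ℚ)))⁻¹) * (1 + 2 * ζ ^ 8) * (ζ + ζ⁻¹) ^ 5) = 0 := by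
  have hΦ := cyc_twentyFour hζ
  rw [trace_of_key hζ (C (-26 : ℚ) + C (0 : ℚ) * X + C (-19 : ℚ) * X ^ 2 + C (0 : ℚ) * X ^ 3 + C (19 : ℚ) * X ^ 4 +
      C (0 : ℚ) * X ^ 5 + C (26 : ℚ) * X ^ 6 + C (0 : ℚ) * X ^ 7) (by compute_degree) (by
    rw [aeval_poly₈]
    push_cast
    linear_combination ((aeval ζ (derivative (cyclotomic 24 ℚ)))⁻¹ * (ζ^3 + 31 * ζ^5 + 30 * ζ^7 + 22 * ζ^9 + 10 * ζ^11 +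
        2 * ζ^13)) * hΦ)]
  norm_num [coeff_X_pow, coeff_X, coeff_C, coeff_one]

/-- `Tr(ζ′sθ^6) = 52` for `ζ′ = ξ = ζ³/Φ′(ζ)`, `s = √−3 = 1 + 2ζ⁸`, `θ = ζ + ζ⁻¹` (Euler evaluation). research route conditional on HC_CM; not a corollary; Q11.4-sentence-2 already refuted in dim ≥ 3. [folklore] -/
theorem trace_xi_sqrtNegThree_six [IsCyclotomicExtension {24} ℚ K] (hζ : IsPrimitiveRoot ζ 24) :
    Algebra.trace ℚ K ((ζ ^ 3 * (aeval ζ (derivative (cyclotomic 24 ℚ)))⁻¹) * (1 + 2 * ζ ^ 8) * (ζ + ζ⁻¹) ^ 6) = 52 := by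
  have hΦ := cyc_twentyFour hζ
  rw [trace_of_key hζ (C (0 : ℚ) + C (-45 : ℚ) * X + C (0 : ℚ) * X ^ 2 + C (-26 : ℚ) * X ^ 3 + C (0 : ℚ) * X ^ 4 +
      C (45 : ℚ) * X ^ 5 + C (0 : ℚ) * X ^ 6 + C (52 : ℚ) * X ^ 7) (by compute_degree) (by
    rw [aeval_poly₈]
    push_cast
    linear_combination ((aeval ζ (derivative (cyclotomic 24 ℚ)))⁻¹ * (ζ^3 + 6 * ζ^5 + 61 * ζ^7 + 52 * ζ^9 + 32 * ζ^11 +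
        12 * ζ^13 + 2 * ζ^15)) * hΦ)]
  norm_num [coeff_X_pow, coeff_X, coeff_C, coeff_one]

/-- **The Gram datum `a` of `(E_ζ′, s)` in the real frame `θ^i` (`i < 4`)** for `ζ′ = ξ = ζ³/Φ′(ζ)` (principal type (1)),
`s = √−3 = 1 + 2ζ⁸`: the integer Hankel matrix `(−Tr(ζ′sθ^{i+j}))ᵢⱼ` (and `b = 0`, part 82 `hb_eq_zero`).
research route conditional on HC_CM; not a corollary; Q11.4-sentence-2 already refuted in dim ≥ 3. [cite: vanGeemen1994HodgeAV, Lemma 5.2 (2)–(3)] -/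
theorem realPart_xi_sqrtNegThree [IsCyclotomicExtension {24} ℚ K] [IsCMField K] (hζ : IsPrimitiveRoot ζ 24)
    {x : Fin 4 → K} (hx : ∀ i, x i = (ζ + ζ⁻¹) ^ (i : ℕ)) {a : Matrix (Fin 4) (Fin 4) ℚ}
    (ha : ∀ i j, a i j = Algebra.trace ℚ K ((ζ ^ 3 * (aeval ζ (derivative (cyclotomic 24 ℚ)))⁻¹) * x i * IsCMField.complexConj K ((1 + 2 * ζ ^ 8) * x j))) :
    a = !![-2, 0, -4, 0; 0, -4, 0, -14; -4, 0, -14, 0; 0, -14, 0, -52] := by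
  rw [ha_eq (complexConj_sqrtNegThree hζ) (complexConj_thetaFrame hζ hx) ha]
  ext i j
  simp only [Matrix.of_apply, hx, ← pow_add]
  fin_cases i <;> fin_cases j <;> simp [trace_xi_sqrtNegThree_zero hζ, trace_xi_sqrtNegThree_one hζ, trace_xi_sqrtNegThree_two hζ, trace_xi_sqrtNegThree_three hζ, trace_xi_sqrtNegThree_four hζ, trace_xi_sqrtNegThree_five hζ, trace_xi_sqrtNegThree_six hζ]

/-- **`det a = 144`** for `ζ′ = ξ = ζ³/Φ′(ζ)`, `s = √−3 = 1 + 2ζ⁸` (frame `θ^i`). research route conditional on HC_CM; not a corollary; Q11.4-sentence-2 already refuted in dim ≥ 3. [cite: vanGeemen1994HodgeAV, Lemma 5.2 (3)] -/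
theorem det_realPart_xi_sqrtNegThree [IsCyclotomicExtension {24} ℚ K] [IsCMField K] (hζ : IsPrimitiveRoot ζ 24)
    {x : Fin 4 → K} (hx : ∀ i, x i = (ζ + ζ⁻¹) ^ (i : ℕ)) {a : Matrix (Fin 4) (Fin 4) ℚ}
    (ha : ∀ i j, a i j = Algebra.trace ℚ K ((ζ ^ 3 * (aeval ζ (derivative (cyclotomic 24 ℚ)))⁻¹) * x i * IsCMField.complexConj K ((1 + 2 * ζ ^ 8) * x j))) :
    a.det = 144 := by
  rw [realPart_xi_sqrtNegThree hζ hx ha]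
  simp [Matrix.det_succ_row_zero, Fin.sum_univ_succ, Fin.succAbove, Matrix.submatrix]
  norm_num

/-! ### §3 Invariance and classes -/

/-- **For EVERY skew `ζ′` of PRINCIPAL type on `ℤ[ζ_24]` (`IsOfType 1 ζ′ ⊤`; `ζ′ = uξ`, `u` a real unit, `N(u) = 1`
by THEOREM L (i) at `24`) the Gram determinant of `(E_ζ′, s₂)` in the frame `θ^i` is `64`** — for every `Φ` and
every `Φ`-positive such `ζ′` (they exist on every `s₂`-balanced `Φ`: the census YES row, part 75
`exists_principal_twentyFour_…`): the SPLIT row W4.2.1 `= (2, ℚ(√−2), 1)`; `(−1)² det a > 0`, the right sign for Weil signature `(2,2)` [vG94 5.2 (4)].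
research route conditional on HC_CM; not a corollary; Q11.4-sentence-2 already refuted in dim ≥ 3. [cite: vanGeemen1994HodgeAV, Lemma 5.2 (3)–(4) and (5.4.1)] [cite: Shimura1998, §14.3 Prop. 5, p. 104] -/
theorem det_realPart_principal_sqrtNegTwo [IsCyclotomicExtension {24} ℚ K] [IsCMField K]
    (hζ : IsPrimitiveRoot ζ 24) {ζ' : K} (hζ' : IsCMField.complexConj K ζ' = -ζ')
    (hT : CMTypeLattice.IsOfType (1 : (FractionalIdeal (𝓞 K)⁰ K)ˣ) ζ' ⊤)
    {x : Fin 4 → K} (hx : ∀ i, x i = (ζ + ζ⁻¹) ^ (i : ℕ)) {a : Matrix (Fin 4) (Fin 4) ℚ}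
    (ha : ∀ i j, a i j = Algebra.trace ℚ K (ζ' * x i * IsCMField.complexConj K ((ζ ^ 3 + ζ ^ 9) * x j))) :
    a.det = 64 := by
  obtain ⟨ωb, hωb⟩ := exists_basis_thetaPow hζ
  have hx' : ∀ i, x i = (ωb i : K) := fun i => (hx i).trans (hωb i).symm
  rw [det_realPart_eq_of_isOfType ωb (complexConj_sqrtNegTwo hζ) hx' (norm_realUnits_pos_twentyFour hζ)
    (complexConj_xi_twentyFour hζ) (xi_ne_zero hζ 3) hζ' (isOfType_one_xi_top hζ 3) hT (fun i j => rfl) ha]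
  exact det_realPart_xi_sqrtNegTwo hζ hx (fun i j => rfl)

/-- **`[64] = [1]`, the SPLIT class, in `ℚˣ/Nm(ℚ(√−2)ˣ)`** (`64 = 8² + 2·0²`): the principally polarised Weil-type
`ℤ[ζ_24]`-fourfolds for `ℚ(√−2)` lie on the SPLIT component — the SPLIT row W4.2.1 `= (2, ℚ(√−2), 1)` (the census's (F3) «`𝒪_K`-linear + principal ⟹
split» for these CM points, as a kernel theorem).
research route conditional on HC_CM; not a corollary; Q11.4-sentence-2 already refuted in dim ≥ 3. [cite: vanGeemen1994HodgeAV, 5.4 and (5.4.1)] -/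
theorem mk0_det_principal_sqrtNegTwo :
    (QuotientGroup.mk (Units.mk0 (64 : ℚ) (by norm_num)) : weilNormResidueGroup 2) = splitDiscriminantClass 2 2 :=
  mk_eq_split_of_even (by decide) _ (mem_normUnitsSubgroup_of_sq_add_mul_sq _ (8 : ℚ) (0 : ℚ) (by norm_num))

/-- **For EVERY skew `ζ′` of PRINCIPAL type on `ℤ[ζ_24]` (`IsOfType 1 ζ′ ⊤`; `ζ′ = uξ`, `u` a real unit, `N(u) = 1`
by THEOREM L (i) at `24`) the Gram determinant of `(E_ζ′, s₃)` in the frame `θ^i` is `144`** — for every `Φ` and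
every `Φ`-positive such `ζ′` (they exist on every `s₃`-balanced `Φ`: the census YES row, part 75
`exists_principal_twentyFour_…`): the SPLIT row W4.3.1 `= (2, ℚ(√−3), 1)`; `(−1)² det a > 0`, the right sign for Weil signature `(2,2)` [vG94 5.2 (4)].
research route conditional on HC_CM; not a corollary; Q11.4-sentence-2 already refuted in dim ≥ 3. [cite: vanGeemen1994HodgeAV, Lemma 5.2 (3)–(4) and (5.4.1)] [cite: Shimura1998, §14.3 Prop. 5, p. 104] -/
theorem det_realPart_principal_sqrtNegThree [IsCyclotomicExtension {24} ℚ K] [IsCMField K]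
    (hζ : IsPrimitiveRoot ζ 24) {ζ' : K} (hζ' : IsCMField.complexConj K ζ' = -ζ')
    (hT : CMTypeLattice.IsOfType (1 : (FractionalIdeal (𝓞 K)⁰ K)ˣ) ζ' ⊤)
    {x : Fin 4 → K} (hx : ∀ i, x i = (ζ + ζ⁻¹) ^ (i : ℕ)) {a : Matrix (Fin 4) (Fin 4) ℚ}
    (ha : ∀ i j, a i j = Algebra.trace ℚ K (ζ' * x i * IsCMField.complexConj K ((1 + 2 * ζ ^ 8) * x j))) :
    a.det = 144 := by
  obtain ⟨ωb, hωb⟩ := exists_basis_thetaPow hζ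
  have hx' : ∀ i, x i = (ωb i : K) := fun i => (hx i).trans (hωb i).symm
  rw [det_realPart_eq_of_isOfType ωb (complexConj_sqrtNegThree hζ) hx' (norm_realUnits_pos_twentyFour hζ)
    (complexConj_xi_twentyFour hζ) (xi_ne_zero hζ 3) hζ' (isOfType_one_xi_top hζ 3) hT (fun i j => rfl) ha]
  exact det_realPart_xi_sqrtNegThree hζ hx (fun i j => rfl)

/-- **`[144] = [1]`, the SPLIT class, in `ℚˣ/Nm(ℚ(√−3)ˣ)`** (`144 = 12² + 3·0²`): the principally polarised Weil-type
`ℤ[ζ_24]`-fourfolds for `ℚ(√−3)` lie on the SPLIT component — the SPLIT row W4.3.1 `= (2, ℚ(√−3), 1)` (the census's (F3) «`𝒪_K`-linear + principal ⟹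
split» for these CM points, as a kernel theorem).
research route conditional on HC_CM; not a corollary; Q11.4-sentence-2 already refuted in dim ≥ 3. [cite: vanGeemen1994HodgeAV, 5.4 and (5.4.1)] -/
theorem mk0_det_principal_sqrtNegThree :
    (QuotientGroup.mk (Units.mk0 (144 : ℚ) (by norm_num)) : weilNormResidueGroup 3) = splitDiscriminantClass 2 3 :=
  mk_eq_split_of_even (by decide) _ (mem_normUnitsSubgroup_of_sq_add_mul_sq _ (12 : ℚ) (0 : ℚ) (by norm_num))

end Summit.HodgeConjecture.Ring2WeilCoverage.WeilGramLevel24SqrtNegTwoThree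

end
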